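import Mathlib.Logic.Equiv.Fin.Basic
import Mathlib.Data.Finset.Card
import Mathlib.Algebra.Order.Group.Abs
import Mathlib.Tactic
import HarnessLib

/-!
# The guesses `(j, α)` of MR07 Thm. 5.9, step 1, and their indexing

Topic `Algebra/EuclideanLattices` (family `pqc`). Small shared file of the `DualGrid` stack: the
reduction of Micciancio–Regev 2007, Thm. 5.9 begins (step 1, authors' version p. 22) by picking
"`j ∈ M = {1,…,m}` and integer `α ∈ B = {−β,…,−1,1,…,β}` uniformly at random"; a machine enumerates
or draws them through naturals. Proved here: `alphaOf βhat a` (the `2·βhat` values `±1,…,±βhat`;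
`alphaOf_ne_zero`, `abs_alphaOf_le`, `exists_alphaOf_eq`), `decIdx`/`decIdx_encode` (an attempt index
`↦ (j, a, repetition)`), `goodIdx`/`card_goodIdx` (the `k₀` attempts at one guess).

## References

* D. Micciancio, O. Regev, *Worst-case to average-case reductions based on Gaussian measures*,
  SIAM J. Comput. 37 (2007) 267–302; authors' version, Thm. 5.9 (step 1, p. 22).
-/

noncomputable section

open scoped Classical

namespace Literature.Algebra.EuclideanLattices

open Finset

namespace DualGrid

variable {n : ℕ}

/-! ### The guesses -/

/-- **The guesses for `α`**: `a < βhat ↦ a + 1`, `a ≥ βhat ↦ -(a - βhat + 1)`. [cite: MicciancioRegev2007, Thm. 5.9 (step 1: "integer α ∈ {−β,…,−1,1,…,β}")] -/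
def alphaOf (βhat : ℕ) (a : Fin (2 * βhat)) : ℤ :=
  if (a : ℕ) < βhat then ((a : ℕ) + 1 : ℕ) else -(((a : ℕ) - βhat + 1 : ℕ) : ℤ)

/-- Every guess is nonzero. [folklore] -/
theorem alphaOf_ne_zero (βhat : ℕ) (a : Fin (2 * βhat)) : alphaOf βhat a ≠ 0 := by
  unfold alphaOf; split_ifs <;> omega

/-- Every guess has `|α| ≤ βhat`. [folklore] -/
theorem abs_alphaOf_le (βhat : ℕ) (a : Fin (2 * βhat)) : |alphaOf βhat a| ≤ βhat := by
  have ha := a.2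
  unfold alphaOf; split_ifs with h
  · rw [abs_of_nonneg (by positivity)]; exact_mod_cast h
  · rw [abs_of_nonpos (by omega)]; omega

/-- Every admissible `α` is a guess. [folklore] -/
theorem exists_alphaOf_eq {βhat : ℕ} {α : ℤ} (h0 : α ≠ 0) (hα : |α| ≤ βhat) : ∃ a : Fin (2 * βhat), alphaOf βhat a = α := by
  rcases lt_or_gt_of_ne h0 with hneg | hpos
  · have h1 : (1 : ℤ) ≤ -α := by omega
    have h2 : -α ≤ βhat := by rw [abs_of_neg hneg] at hα; exact hα
    refine ⟨⟨βhat + ((-α).toNat - 1), by omega⟩, ?_⟩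
    unfold alphaOf
    simp only
    rw [if_neg (by omega)]
    omega
  · have h2 : α ≤ βhat := by rw [abs_of_pos hpos] at hα; exact hα
    refine ⟨⟨α.toNat - 1, by omega⟩, ?_⟩
    unfold alphaOf
    simp only
    rw [if_pos (by omega)]
    omega

/-! ### Attempt indices -/

/-- Decoding an attempt index into (guess position `j`, guess `a`, repetition). [folklore] -/
def decIdx (m βhat k₀ : ℕ) (idx : Fin (m * (2 * βhat) * k₀)) : Fin m × Fin (2 * βhat) × Fin k₀ :=
  ((finProdFinEquiv.symm (finProdFinEquiv.symm idx).1).1, (finProdFinEquiv.symm (finProdFinEquiv.symm idx).1).2,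
    (finProdFinEquiv.symm idx).2)

/-- Encoding is inverse to decoding. [folklore] -/
theorem decIdx_encode (m βhat k₀ : ℕ) (j : Fin m) (a : Fin (2 * βhat)) (t : Fin k₀) :
    decIdx m βhat k₀ (finProdFinEquiv (finProdFinEquiv (j, a), t)) = (j, a, t) := by
  simp [decIdx]

/-- The attempts at the guess `(j, a)`. [folklore] -/
def goodIdx (m βhat k₀ : ℕ) (j : Fin m) (a : Fin (2 * βhat)) : Finset (Fin (m * (2 * βhat) * k₀)) :=
  Finset.univ.filter fun idx => (decIdx m βhat k₀ idx).1 = j ∧ (decIdx m βhat k₀ idx).2.1 = a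

/-- There are `k₀` attempts at each guess. [folklore] -/
theorem card_goodIdx (m βhat k₀ : ℕ) (j : Fin m) (a : Fin (2 * βhat)) : (goodIdx m βhat k₀ j a).card = k₀ := by
  have hset : goodIdx m βhat k₀ j a =
      (Finset.univ : Finset (Fin k₀)).image fun t => finProdFinEquiv (finProdFinEquiv (j, a), t) := by
    ext idx
    simp only [goodIdx, Finset.mem_filter, Finset.mem_univ, true_and, Finset.mem_image]
    constructor
    · rintro ⟨h1, h2⟩
      refine ⟨(finProdFinEquiv.symm idx).2, ?_⟩
      simp only [decIdx] at h1 h2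
      apply finProdFinEquiv.symm.injective
      rw [Equiv.symm_apply_apply]
      refine Prod.ext ?_ rfl
      apply finProdFinEquiv.symm.injective
      rw [Equiv.symm_apply_apply]
      exact Prod.ext h1.symm h2.symm
    · rintro ⟨t, rfl⟩
      simp [decIdx_encode]
  rw [hset, Finset.card_image_of_injective _ fun t₁ t₂ h => by simpa using h, Finset.card_univ, Fintype.card_fin]

end DualGrid

end Literature.Algebra.EuclideanLattices

end
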